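import Summits.Ventures.CertifiedArithmetic.LowPrec.RoundToOdd

/-!
# Ties-to-even inflates a sum by less than it may deflate it (the RNE inflation asymmetry)

HONEST FRAMING (venture CertifiedArithmetic / cell `pub-lowprec`): certified error envelopes and
provably optimal rounding/accumulation schemes for low-precision formats under stated cost models;
every table by two implementations; no hardware or vendor claims.

For data `a, b` of a format and `x = a + b` in range, the optimal relative error of one addition
is `|fl(x) - x| ≤ u/(1+u)·|x|` [JeannerodRump2018, (4.1)], attained at the midpoints
`2^k(1+u)` — where ties-to-even rounds DOWN in magnitude (to the even `2^k`).  THIS FILE: under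
round-to-nearest ties-to-EVEN an addition can INFLATE the magnitude only by strictly less:

  **`|fl(a+b)| > |a+b|  ⟹  |fl(a+b) - (a+b)| · (1 + 2u + 2u²) < u · |a+b|`**

(`abs_err_lt_of_inflation`; note `u/(1+2u+2u²) < u/(1+u)² < u/(1+u)`), for every format with
`m ≥ 1`, every pair of data with `|a+b| ≤ maxRat`, gradual underflow included.  Mechanism: with
`Y < x < X = fl(x)` the bracketing data (`X = Y + G`, `G` = ulp), nearest rounding gives
`X - x ≤ G/2`; if `Y` is not the bottom of its binade, `x ≥ (2^m + 3/2)·G` and the ratio is at most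
`u/(1+3u)`; if `Y = 2^m·G` is the bottom, the tie `Y + G/2` would go to the EVEN `Y` (so `x` lies
strictly above it) and GRANULARITY takes over: `x` is a multiple of the smaller operand's ulp `g`,
so is the midpoint, hence `x ≥ Y + G/2 + g`, while the error is at most the smaller operand
`< 2^(m+1)·g = g/u`; the two facts give the bound.  Under ties-AWAY the midpoint `2^k(1+u)` itself
inflates by the full `u/(1+u)`: the asymmetry is specific to ties-to-even.  It is what makes
ascending error chains under ties-to-even pay a parity switch (gemm.tex Prop. p:sharp,
`LangeRumpToleranceZero`) and the structural reason balanced trees keep obeying the signed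
tree-polynomial law in all implementation-A scans (`SIGNED-TREE-LAW.md` §3c) although general trees
do not (`OptTreePolySignedRefutation`).  Brute force (`code/lean/signed_treelaw/inflation_check.py`,
`p = 3..6`, all pairs in a 6-binade window): maximal inflation ratios `7/73, 5/91, 31/1057, 1/67`,
all below `u/(1+2u+2u²)`; maximal deflation `u/(1+u)` exactly.  Presearch: the symmetric refinement
`|fl(x+y) - (x+y)| ≤ min{u|x+y|, |x|, |y|}` is [Jeannerod, MACIS 2015 survey, eq. (5)]
[corpus: book:kotsireas2016 p.42]; no tie-rule-dependent inflation bound was located (corpus hybrid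
search 2026-08-20) — stated here as an elementary structural lemma, proved for the formats.
-/

namespace Literature.ComputerArithmetic.FloatingPoint

namespace MiniFloat

open Format

variable {φ : Format}

/-! ## §1 The positive case -/

/-- RNE INFLATION ASYMMETRY (positive case): for data `a, b` with `0 < a + b ≤ maxRat` and
`fl(a+b) > a + b` (the rounding inflated the sum), `(fl(a+b) - (a+b))·(1 + 2u + 2u²) < u·(a+b)`
(`m ≥ 1`). [folklore] -/
theorem err_lt_of_inflation_pos (hm : 1 ≤ φ.manBits) (a b : MiniFloat φ)
    (hx0 : 0 < a.toRat + b.toRat) (hr : a.toRat + b.toRat ≤ φ.maxRat)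
    (hinf : a.toRat + b.toRat < (roundNE φ (a.toRat + b.toRat)).toRat) :
    ((roundNE φ (a.toRat + b.toRat)).toRat - (a.toRat + b.toRat))
        * (1 + 2 * φ.unitRoundoff + 2 * φ.unitRoundoff ^ 2)
      < φ.unitRoundoff * (a.toRat + b.toRat) := by
  have hq := φ.quantum_pos
  -- the smaller operand first (the statement is symmetric in `a`, `b`)
  wlog hab : a.scaledMag ≤ b.scaledMag generalizing a b
  · have h := this b a (by rwa [add_comm]) (by rwa [add_comm]) (by rwa [add_comm])
      (le_of_not_ge hab)
    rwa [add_comm b.toRat] at h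
  set x := a.toRat + b.toRat with hx_def
  have habs : |x| ≤ φ.maxRat := by rw [abs_of_pos hx0]; exact hr
  set u := φ.unitRoundoff with hu_def
  have hupos : 0 < u := φ.unitRoundoff_pos
  have hu : u * 2 ^ (φ.manBits + 1) = 1 := by
    rw [hu_def, Format.unitRoundoff_eq]; field_simp
  have hu2 : u * 2 ^ φ.manBits = 1 / 2 := by
    have : u * 2 ^ (φ.manBits + 1) = 2 * (u * 2 ^ φ.manBits) := by rw [pow_succ]; ring
    linarith
  have hu4 : u ≤ 1 / 4 := by
    have h4 : (4 : ℚ) ≤ 2 ^ (φ.manBits + 1) :=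
      calc (4 : ℚ) = 2 ^ (1 + 1) := by norm_num
        _ ≤ 2 ^ (φ.manBits + 1) := pow_le_pow_right₀ (by norm_num) (by omega)
    nlinarith
  -- integer coordinates: x = S·q
  obtain ⟨S, hS_def⟩ : ∃ S : ℤ, S = a.toInt + b.toInt := ⟨_, rfl⟩
  have hxS : x = (S : ℚ) * φ.quantum := by
    rw [hx_def, toRat_eq_toInt_mul, toRat_eq_toInt_mul, hS_def]; push_cast; ring
  have hS0 : 0 < S := by
    by_contra h
    have h' : (S : ℚ) ≤ 0 := by exact_mod_cast not_lt.mp h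
    have : x ≤ 0 := by rw [hxS]; exact mul_nonpos_of_nonpos_of_nonneg h' hq.le
    linarith
  have hSmax : S.natAbs ≤ φ.maxScaled := by
    have h1 : (S : ℚ) * φ.quantum ≤ (φ.maxScaled : ℚ) * φ.quantum := by
      rw [← hxS]; exact hr
    have h2 : (S : ℚ) ≤ φ.maxScaled := le_of_mul_le_mul_right h1 hq
    have h3 : S ≤ (φ.maxScaled : ℤ) := by exact_mod_cast h2
    omega
  -- Step 1: `S ≥ 2^(m+1)`, else `x` is a value of the format and `fl x = x`
  have hbig : 2 ^ (φ.manBits + 1) ≤ S.natAbs := by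
    by_contra hlt
    have hrep : φ.Representable S.natAbs := representable_of_lt_pow (not_le.mp hlt) hSmax
    obtain ⟨y, hy⟩ := exists_toRat_eq_intCast_mul S hrep
    have : (roundNE φ x).toRat = x := by rw [hxS, ← hy, toRat_roundNE_toRat]
    linarith
  -- Step 2: the bracketing data `Y < x < X = Y + G`
  obtain ⟨Y, hY_def⟩ : ∃ Y : MiniFloat φ, Y = roundDown φ x := ⟨_, rfl⟩
  have hYx : Y.toRat ≤ x := by rw [hY_def]; exact toRat_roundDown_le habs
  have hY0 : 0 ≤ Y.toRat := by
    have := toRat_le_roundDown habs (MiniFloat.zero φ) (by rw [toRat_zero]; exact hx0.le)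
    rwa [toRat_zero, ← hY_def] at this
  have hYX : Y.toRat < (roundNE φ x).toRat := lt_of_le_of_lt hYx hinf
  obtain ⟨Z, hZ⟩ := exists_toRat_eq_add_ulp hY0 hYX
  have hZX : Z.toRat ≤ (roundNE φ x).toRat := by rw [hZ]; exact add_ulp_le_of_lt hY0 hYX
  have hGpos : (0 : ℚ) < 2 ^ (Y.expCode - 1) * φ.quantum := by positivity
  have hxZ : x < Z.toRat := by
    by_contra h
    have := toRat_le_roundDown habs Z (not_lt.mp h)
    rw [← hY_def, hZ] at this
    linarith
  have hXval : (roundNE φ x).toRat = Y.toRat + 2 ^ (Y.expCode - 1) * φ.quantum := by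
    have h1 := roundNE_nearest (φ := φ) x Z
    rw [abs_of_neg (by linarith), abs_of_neg (by linarith)] at h1
    rw [← hZ]; linarith
  have hnearY : (roundNE φ x).toRat - x ≤ x - Y.toRat := by
    have h1 := roundNE_nearest (φ := φ) x Y
    rwa [abs_of_neg (by linarith), abs_of_nonneg (by linarith), neg_sub] at h1
  -- Step 3: `Y` is normal with `expCode ≥ 2`
  have hYs : Y.toRat = (Y.scaledMag : ℚ) * φ.quantum := by
    rw [toRat_eq_toInt_mul, toInt_eq_scaledMag_of_nonneg hY0]; push_cast; ring
  have hYbig : 2 ^ (φ.manBits + 1) ≤ Y.scaledMag := by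
    have hrep : φ.Representable (2 ^ (φ.manBits + 1)) :=
      representable_of_pow_dvd (g := φ.manBits + 1) dvd_rfl
        (Nat.pow_le_pow_right (by norm_num) (by omega)) (le_trans hbig hSmax)
    obtain ⟨w, hw⟩ := exists_toRat_eq_intCast_mul (φ := φ) ((2 ^ (φ.manBits + 1) : ℕ) : ℤ)
      (by rw [Int.natAbs_natCast]; exact hrep)
    have hwx : w.toRat ≤ x := by
      rw [hw, hxS]
      have : (((2 ^ (φ.manBits + 1) : ℕ) : ℤ) : ℚ) ≤ (S : ℚ) := by
        have : ((2 ^ (φ.manBits + 1) : ℕ) : ℤ) ≤ S := by omega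
        exact_mod_cast this
      exact mul_le_mul_of_nonneg_right this hq.le
    have hwY := toRat_le_roundDown habs w hwx
    rw [hw, ← hY_def, hYs] at hwY
    have := le_of_mul_le_mul_right hwY hq
    exact_mod_cast this
  have hEY : 2 ≤ Y.expCode := by
    by_contra h
    have h1 := scaledMag_lt_pow_ulpExp Y
    have h' : Y.expCode - 1 = 0 := by omega
    rw [h', add_zero] at h1
    omega
  -- notation for the final estimates (rationals)
  obtain ⟨G, hG_def⟩ : ∃ G : ℚ, G = ((2 ^ (Y.expCode - 1) : ℕ) : ℚ) := ⟨_, rfl⟩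
  have hGq : (2 : ℚ) ^ (Y.expCode - 1) = G := by rw [hG_def]; push_cast; ring
  have hGpos' : 0 < G := by rw [hG_def]; positivity
  obtain ⟨e, he_def⟩ : ∃ e : ℚ, e = (roundNE φ x).toRat - x := ⟨_, rfl⟩
  rw [← he_def]
  have hxY : x = Y.toRat + G * φ.quantum - e := by rw [← hGq]; linarith [hXval, he_def]
  have he_le : 2 * e ≤ G * φ.quantum := by linarith [hnearY, hxY]
  have he_pos : 0 < e := by linarith [hinf, he_def]
  have hYscaled : Y.scaledMag = (2 ^ φ.manBits + Y.man) * 2 ^ (Y.expCode - 1) := by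
    unfold scaledMag Format.scaled; rw [if_neg (by omega)]
  by_cases hman : 1 ≤ Y.man
  · -- Case A: `Y` is not the bottom of its binade: `x ≥ (2^m + 3/2)·G`
    have hYge : ((2 ^ φ.manBits + 1 : ℕ) : ℚ) * G * φ.quantum ≤ Y.toRat := by
      rw [hYs, hG_def]
      have : (2 ^ φ.manBits + 1) * 2 ^ (Y.expCode - 1) ≤ Y.scaledMag := by
        rw [hYscaled]; exact Nat.mul_le_mul_right _ (by omega)
      have : (((2 ^ φ.manBits + 1) * 2 ^ (Y.expCode - 1) : ℕ) : ℚ) ≤ (Y.scaledMag : ℚ) := by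
        exact_mod_cast this
      push_cast at this ⊢
      nlinarith
    have hxge : ((2 ^ φ.manBits + 1 : ℕ) : ℚ) * G * φ.quantum + G * φ.quantum / 2 ≤ x := by
      linarith [hxY, he_le, hYge]
    push_cast at hxge
    have hGq0 : 0 < G * φ.quantum := by rw [hG_def]; positivity
    -- e(1+2u+2u²) ≤ (G q/2)(1+2u+2u²) < (G q/2)(1+3u) ≤ u·x
    have h1 : e * (1 + 2 * u + 2 * u ^ 2) ≤ G * φ.quantum / 2 * (1 + 2 * u + 2 * u ^ 2) :=
      mul_le_mul_of_nonneg_right (by linarith) (by positivity)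
    have h2 : G * φ.quantum / 2 * (1 + 2 * u + 2 * u ^ 2) < G * φ.quantum / 2 * (1 + 3 * u) := by
      apply mul_lt_mul_of_pos_left _ (by linarith)
      nlinarith
    have h3 : G * φ.quantum / 2 * (1 + 3 * u) ≤ u * x := by
      have := mul_le_mul_of_nonneg_left hxge hupos.le
      have hux : u * (2 : ℚ) ^ φ.manBits * G * φ.quantum = G * φ.quantum / 2 := by
        rw [hu2]; ring
      nlinarith
    linarith
  · -- Case B: `Y = 2^m·G` is the bottom of its binade
    have hman0 : Y.man = 0 := by omega
    have hYval : Y.toRat = (2 : ℚ) ^ φ.manBits * G * φ.quantum := by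
      rw [hYs, hYscaled, hman0, hG_def]; push_cast; ring
    -- B1: the tie `x = Y + G/2` is impossible (it would round to the even `Y`, not up)
    have hXs : (roundNE φ x).scaledMag = (2 ^ φ.manBits + 1) * 2 ^ (Y.expCode - 1) := by
      apply scaledMag_eq_of_toRat_eq
      rw [hXval, hYval, hG_def]; push_cast; ring
    have hne : x ≠ Y.toRat + G * φ.quantum / 2 := by
      intro htie
      have hev : 2 ∣ (roundNE φ x).man := by
        refine roundNE_man_even_of_tie hm (y := Y) ?_ ?_
        · rw [hXval, hGq, htie]
          rw [show Y.toRat + G * φ.quantum / 2 - Y.toRat = G * φ.quantum / 2 by ring,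
            show Y.toRat + G * φ.quantum / 2 - (Y.toRat + G * φ.quantum)
              = -(G * φ.quantum / 2) by ring, abs_neg]
        · rw [hXval]; linarith
      rw [two_dvd_man_iff hm, hXs] at hev
      have hEX : Y.expCode - 1 ≤ (roundNE φ x).expCode - 1 :=
        ulpExp_mono (by rw [hXs, hYscaled, hman0]; exact Nat.mul_le_mul_right _ (by omega))
      obtain ⟨r, hr'⟩ := Nat.exists_eq_add_of_le hEX
      have h2 : 2 ^ (Y.expCode - 1) * 2 ∣ (2 ^ φ.manBits + 1) * 2 ^ (Y.expCode - 1) := by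
        refine dvd_trans ⟨2 ^ r, ?_⟩ hev
        rw [hr', pow_add]; ring
      rw [mul_comm (2 ^ φ.manBits + 1)] at h2
      have h3 : 2 ∣ 2 ^ φ.manBits + 1 := Nat.dvd_of_mul_dvd_mul_left (by positivity) h2
      have h4 : 2 ∣ 2 ^ φ.manBits := dvd_pow_self 2 (by omega)
      omega
    have hxgt : Y.toRat + G * φ.quantum / 2 < x :=
      lt_of_le_of_ne (by linarith [hxY, he_le]) (Ne.symm hne)
    -- B2: granularity.  `g` = ulp of the smaller operand `a`
    obtain ⟨g, hg_def⟩ : ∃ g : ℚ, g = ((2 ^ (a.expCode - 1) : ℕ) : ℚ) := ⟨_, rfl⟩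
    have hgpos : 0 < g := by rw [hg_def]; positivity
    -- (g1) `g ∣ S`
    have hgS : ((2 ^ (a.expCode - 1) : ℕ) : ℤ) ∣ S := by
      rw [hS_def]; exact dvd_add (pow_ulpExp_dvd_toInt le_rfl) (pow_ulpExp_dvd_toInt hab)
    -- (g2) the error is at most the smaller operand: `e ≤ |a|`
    have he_a : e ≤ (a.scaledMag : ℚ) * φ.quantum := by
      have h1 := roundNE_nearest (φ := φ) x b
      rw [abs_of_neg (by linarith : x - (roundNE φ x).toRat < 0)] at h1
      rw [show x - b.toRat = a.toRat by rw [hx_def]; ring, abs_toRat] at h1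
      rw [he_def]; linarith
    -- (g3) `|a| < 2^(m+1)·g`
    have ha_lt : (a.scaledMag : ℚ) < 2 ^ (φ.manBits + 1) * g := by
      rw [hg_def]; exact_mod_cast (by rw [← pow_add]; exact scaledMag_lt_pow_ulpExp a)
    -- (g4) `|a| < Y`: otherwise both operands are multiples of `G` and so is `S`, forcing `S = Y`
    have ha_Y : a.scaledMag < Y.scaledMag := by
      by_contra h
      have hYa : Y.scaledMag ≤ a.scaledMag := not_lt.mp h
      have hGa : ((2 ^ (Y.expCode - 1) : ℕ) : ℤ) ∣ a.toInt := pow_ulpExp_dvd_toInt hYa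
      have hGb : ((2 ^ (Y.expCode - 1) : ℕ) : ℤ) ∣ b.toInt :=
        pow_ulpExp_dvd_toInt (le_trans hYa hab)
      have hGS : ((2 ^ (Y.expCode - 1) : ℕ) : ℤ) ∣ S := by rw [hS_def]; exact dvd_add hGa hGb
      have hGY : ((2 ^ (Y.expCode - 1) : ℕ) : ℤ) ∣ (Y.scaledMag : ℤ) := by
        exact_mod_cast pow_ulpExp_dvd_scaledMag Y
      -- `Ys ≤ S < Ys + G` in integers
      have hlo : (Y.scaledMag : ℤ) ≤ S := by
        have : (Y.scaledMag : ℚ) * φ.quantum ≤ (S : ℚ) * φ.quantum := by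
          rw [← hYs, ← hxS]; exact hYx
        exact_mod_cast le_of_mul_le_mul_right this hq
      have hhi : S < (Y.scaledMag : ℤ) + ((2 ^ (Y.expCode - 1) : ℕ) : ℤ) := by
        have : (S : ℚ) * φ.quantum < ((Y.scaledMag : ℚ) + 2 ^ (Y.expCode - 1)) * φ.quantum := by
          rw [← hxS, add_mul, ← hYs, ← hXval]; exact hinf
        have := lt_of_mul_lt_mul_right this hq.le
        exact_mod_cast this
      obtain ⟨c1, hc1⟩ := hGS
      obtain ⟨c2, hc2⟩ := hGY
      have hGp : (0 : ℤ) < ((2 ^ (Y.expCode - 1) : ℕ) : ℤ) := by positivity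
      have hc : c1 = c2 := by
        have h1 : c2 ≤ c1 := le_of_mul_le_mul_left (by rw [← hc1, ← hc2]; exact hlo) hGp
        have h2 : c1 < c2 + 1 :=
          lt_of_mul_lt_mul_left (by rw [mul_add, mul_one, ← hc1, ← hc2]; exact hhi) hGp.le
        omega
      have hSY : S = Y.scaledMag := by rw [hc1, hc2, hc]
      have : (roundNE φ x).toRat = x := by
        rw [hxS, hSY,
          show ((Y.scaledMag : ℤ) : ℚ) * φ.quantum = Y.toRat by rw [hYs]; push_cast; ring,
          toRat_roundNE_toRat]
      linarith
    -- (g5) hence `expCode a ≤ expCode Y - 1` and `g ∣ G/2`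
    have hEa : a.expCode - 1 ≤ Y.expCode - 2 := by
      by_contra h
      have hE1 : 1 ≤ a.expCode := by omega
      have h1 := pow_le_scaledMag_of_expCode_pos a hE1
      have h2 : 2 ^ (φ.manBits + (Y.expCode - 1)) ≤ 2 ^ (φ.manBits + (a.expCode - 1)) :=
        Nat.pow_le_pow_right (by norm_num) (by omega)
      rw [hYscaled, hman0, add_zero, ← pow_add] at ha_Y
      omega
    -- (g6) `S > μ = Ys + G/2` and both are multiples of `g`, so `S ≥ μ + g`
    have hGhalf : ((2 ^ (Y.expCode - 1) : ℕ) : ℤ) = 2 * 2 ^ (Y.expCode - 2) := by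
      rw [show Y.expCode - 1 = (Y.expCode - 2) + 1 by omega, pow_succ]; push_cast; ring
    obtain ⟨μ, hμ_def⟩ : ∃ μ : ℤ, μ = (Y.scaledMag : ℤ) + 2 ^ (Y.expCode - 2) := ⟨_, rfl⟩
    have hμg : ((2 ^ (a.expCode - 1) : ℕ) : ℤ) ∣ μ := by
      have h1 : ((2 ^ (a.expCode - 1) : ℕ) : ℤ) ∣ (2 : ℤ) ^ (Y.expCode - 2) := by
        push_cast; exact pow_dvd_pow 2 hEa
      rw [hμ_def]
      refine dvd_add ?_ h1
      rw [hYscaled, hman0]; push_cast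
      rw [show (Y.expCode - 1) = (Y.expCode - 2) + 1 by omega, pow_succ]
      exact Dvd.dvd.mul_left (Dvd.dvd.mul_right h1 _) _
    have hSμ : μ < S := by
      have : ((μ : ℤ) : ℚ) * φ.quantum < (S : ℚ) * φ.quantum := by
        rw [← hxS]
        have hμq : ((μ : ℤ) : ℚ) * φ.quantum = Y.toRat + G * φ.quantum / 2 := by
          rw [hμ_def, hYs, hG_def]; push_cast
          rw [show (Y.expCode - 1) = (Y.expCode - 2) + 1 by omega, pow_succ]; ring
        rw [hμq]; exact hxgt
      exact_mod_cast lt_of_mul_lt_mul_right this hq.le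
    have hSge : μ + ((2 ^ (a.expCode - 1) : ℕ) : ℤ) ≤ S := by
      have hd : ((2 ^ (a.expCode - 1) : ℕ) : ℤ) ∣ S - μ := dvd_sub hgS hμg
      have := Int.le_of_dvd (by omega) hd
      omega
    -- the three rational inequalities
    have hμq : ((μ : ℤ) : ℚ) * φ.quantum = Y.toRat + G * φ.quantum / 2 := by
      rw [hμ_def, hYs, hG_def]; push_cast
      rw [show (Y.expCode - 1) = (Y.expCode - 2) + 1 by omega, pow_succ]; ring
    have hcast : ((μ : ℤ) : ℚ) + g ≤ (S : ℚ) := by rw [hg_def]; exact_mod_cast hSge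
    have hSq : ((μ : ℤ) : ℚ) * φ.quantum + g * φ.quantum ≤ (S : ℚ) * φ.quantum := by
      have := mul_le_mul_of_nonneg_right hcast hq.le; rwa [add_mul] at this
    have hx_lb : Y.toRat + G * φ.quantum / 2 + g * φ.quantum ≤ x := by
      rw [hxS]; linarith only [hSq, hμq]
    have hI1 : e ≤ G * φ.quantum / 2 - g * φ.quantum := by linarith only [hx_lb, hxY]
    have hI2 : u * e < g * φ.quantum := by
      have h1 : u * e ≤ u * ((a.scaledMag : ℚ) * φ.quantum) :=
        mul_le_mul_of_nonneg_left he_a hupos.le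
      have h2 : (a.scaledMag : ℚ) * φ.quantum < (2 ^ (φ.manBits + 1) * g) * φ.quantum :=
        mul_lt_mul_of_pos_right ha_lt hq
      have h3 : u * ((a.scaledMag : ℚ) * φ.quantum) < u * ((2 ^ (φ.manBits + 1) * g) * φ.quantum) :=
        mul_lt_mul_of_pos_left h2 hupos
      have h4 : u * ((2 ^ (φ.manBits + 1) * g) * φ.quantum) = g * φ.quantum := by
        rw [show u * ((2 ^ (φ.manBits + 1) * g) * φ.quantum)
          = (u * 2 ^ (φ.manBits + 1)) * (g * φ.quantum) by ring, hu, one_mul]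
      linarith only [h1, h3, h4]
    have hI3 : G * φ.quantum / 2 + u * (G * φ.quantum / 2) + u * (g * φ.quantum) ≤ u * x := by
      have hx_lb' :
          (2 : ℚ) ^ φ.manBits * G * φ.quantum + G * φ.quantum / 2 + g * φ.quantum ≤ x := by
        rw [← hYval]; exact hx_lb
      have h1 := mul_le_mul_of_nonneg_left hx_lb' hupos.le
      have h2 : u * ((2 : ℚ) ^ φ.manBits * G * φ.quantum + G * φ.quantum / 2 + g * φ.quantum)
          = (u * 2 ^ φ.manBits) * (G * φ.quantum) + u * (G * φ.quantum / 2)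
            + u * (g * φ.quantum) := by ring
      rw [h2, hu2] at h1
      linarith only [h1]
    -- combine: (1+u)e < G q/2 and u x ≥ (1+u) G q/2 + u g q > (1+u)² e + u² e
    have h1u : (0 : ℚ) < 1 + u := by linarith
    have hA : (1 + u) * e < G * φ.quantum / 2 := by
      have : (1 + u) * e = e + u * e := by ring
      linarith only [this, hI1, hI2]
    have hB := mul_lt_mul_of_pos_left hA h1u
    have hC := mul_lt_mul_of_pos_left hI2 hupos
    have hexp : e * (1 + 2 * u + 2 * u ^ 2) = (1 + u) * ((1 + u) * e) + u * (u * e) := by ring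
    have hB' : (1 + u) * ((1 + u) * e) < G * φ.quantum / 2 + u * (G * φ.quantum / 2) := by
      have : (1 + u) * (G * φ.quantum / 2) = G * φ.quantum / 2 + u * (G * φ.quantum / 2) := by ring
      linarith only [hB, this]
    rw [hexp]
    linarith only [hB', hC, hI3]

/-! ## §2 Both signs -/

/-- **THE RNE INFLATION ASYMMETRY**: for data `a, b` of a format with `m ≥ 1` and `|a+b| ≤ maxRat`,
if round-to-nearest-even INFLATES the sum (`|fl(a+b)| > |a+b|`) then
`|fl(a+b) - (a+b)|·(1 + 2u + 2u²) < u·|a+b|` — strictly below the deflation bound `u/(1+u)`.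
[folklore] -/
theorem abs_err_lt_of_inflation (hm : 1 ≤ φ.manBits) (a b : MiniFloat φ)
    (hr : |a.toRat + b.toRat| ≤ φ.maxRat)
    (hinf : |a.toRat + b.toRat| < |(roundNE φ (a.toRat + b.toRat)).toRat|) :
    |(roundNE φ (a.toRat + b.toRat)).toRat - (a.toRat + b.toRat)|
        * (1 + 2 * φ.unitRoundoff + 2 * φ.unitRoundoff ^ 2)
      < φ.unitRoundoff * |a.toRat + b.toRat| := by
  set x := a.toRat + b.toRat with hx_def
  rcases lt_trichotomy x 0 with hneg | hzero | hpos
  · -- mirror through the sign flip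
    have hx' : 0 < a.flipSign.toRat + b.flipSign.toRat := by
      rw [toRat_flipSign, toRat_flipSign]; linarith
    have hX0 : (roundNE φ x).toRat ≤ 0 := by
      have := toRat_roundNE_mono (φ := φ) hneg.le
      rwa [toRat_roundNE_zero] at this
    have hinf' : -x < -(roundNE φ x).toRat := by
      rw [abs_of_neg hneg, abs_of_nonpos hX0] at hinf; exact hinf
    have h := err_lt_of_inflation_pos hm a.flipSign b.flipSign hx'
      (by rw [toRat_flipSign, toRat_flipSign, ← neg_add, ← hx_def]; rw [abs_of_neg hneg] at hr;
          exact hr)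
      (by rw [toRat_flipSign, toRat_flipSign, ← neg_add, ← hx_def, toRat_roundNE_neg]; exact hinf')
    rw [toRat_flipSign, toRat_flipSign, ← neg_add, ← hx_def, toRat_roundNE_neg] at h
    rw [abs_of_neg hneg, abs_of_neg (show (roundNE φ x).toRat - x < 0 by linarith),
      show -((roundNE φ x).toRat - x) = -(roundNE φ x).toRat - -x by ring]
    exact h
  · rw [hzero, toRat_roundNE_zero] at hinf; simp at hinf
  · have hX0 : 0 ≤ (roundNE φ x).toRat := by
      have := toRat_roundNE_mono (φ := φ) hpos.le
      rwa [toRat_roundNE_zero] at this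
    rw [abs_of_pos hpos, abs_of_nonneg hX0] at hinf
    rw [abs_of_pos hpos, abs_of_pos (by linarith : 0 < (roundNE φ x).toRat - x)]
    exact err_lt_of_inflation_pos hm a b hpos (by rw [abs_of_pos hpos] at hr; exact hr) hinf

end MiniFloat

end Literature.ComputerArithmetic.FloatingPoint
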